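import Mathlib.Tactic.Linarith
import Mathlib.Tactic.NormNum
import HarnessLib

/-!
# The CELL score of the material-oracle acceptance test (ACCEPTANCE §2.3 truth derivation, §4.3 cell
# agreement, §4.4 T_c-band «INSIDE», §4.1 W3 column consistency) as total functions, with the
# property sheet both python scorers rely on PROVED

Venture CertifiedManyBodySolver, cell `pub/hubbard-downfold` (HUMAN RULINGS D-0098/D-0099: «our system
should be able to correctly differentiate between all known superconductor claims … this material
superconducts or doesn't along this range of temperatures and pressures»; the oracle's per-material
(T × P × H) PHASE MAP is scored cell by cell against a curated diagram), seat hubbard-downfold-score-1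
(second scoring engine); namespace `Summit.Ventures.CertifiedManyBodySolver.Downfold.CellScore`.
Companion of `RouterWordScore.lean` (score-2, the LEVEL-1 router-word score); this file is LEVELS 2–3.
Everything here is PROVED (linear arithmetic over `ℚ`; the scorers' floats are decimal literals).

WHAT THIS IS NOT: not a statement about any material, not a certificate, not the scorer of record (those
are `ladder-directors/deputy-2/score.py`, ACCEPTANCE.md v1.2, and the second engine
`pub/hubbard-downfold/validation/score/phasemap.py`; they agree on 1 615 429 compared quantities over 28 800
synthetic maps, kit j258082). This file is the KERNEL REFERENCE for the cell-level rules both implement, and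
turns three sentences the acceptance text and the cell's PASS criteria use in prose into theorems:

* §1–§2 objects: cell truth of a superconducting column `truthSC Tc τ T` (T = 0 ⇒ SC; T < Tc − τ ⇒ SC;
  T > Tc + τ ⇒ not; else unknown — §2.3 verbatim) and of a measured-normal column `truthNoSC Tmin T`
  (T ≥ T_min ⇒ not, else unknown); the tolerance `tau Tc err = max(err, 1 K, 5 %·Tc)`; the map WORD; the
  cell OUTCOME (§4.3: undetermined ⇒ abstain «counted, not a miss»; decided ∧ truth unknown ⇒ unscored; else
  agree/disagree); `inside lo hi Tc τ` (§4.4: Tc ∈ [lo − τ, hi + τ]) and the producer-side column rule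
  `w3Cell lo hi T w` (§4.1 W3: T < lo ⇒ word ≠ not; T > hi ⇒ word ≠ SC), Booleans as the scorers print them.
* §3 THEOREMS. (a) HONESTY `outcome_undetermined`, `outcome_unknown_ne_disagree`: an undetermined word or
  an unknown truth is never a disagreement. (b) MONOTONICITY `truthSC_SC_anti`, `truthSC_not_mono`: the truth
  column is SC below, unknown inside the tolerance, not above. (c) INSIDE-BAND THEOREM
  `outcome_ne_disagree_of_inside`: band INSIDE (§4.4) ∧ column W3-consistent ⇒ no decided cell OUTSIDE
  [lo, hi] disagrees — an inside band loses cell accuracy only through words decided inside the band.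
  (d) MISS THEOREMS `disagree_or_undetermined_of_missHigh` / `_of_missLow`: a band missing by more than τ
  FORCES a disagreement (or an abstention) at every grid temperature between the truth edge and the band
  edge — level 3 («inside-band») and level 2 («cell accuracy») are not independent numbers. (e) measured-
  normal columns: `outcome_ne_disagree_noSC_of_hi_lt` (band below T_min costs nothing),
  `disagree_or_undetermined_of_falseBand` (§4.4 FALSE-BAND forces disagreements on [T_min, lo)).
  (f) `one_le_tau`, `err_le_tau`, `twentieth_le_tau`.
* §4 the MgB₂ column of the truth file of record (M07: T_c = 39 ± 1 K ⇒ τ = 39/20 K) evaluated by the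
  kernel at the T22 grid points the python engines' unit tests use (three-way agreement python = python =
  kernel on the worked numbers).

Design: `ℚ` (every map/truth number is a finite decimal; the rules are comparisons and one `max`; the §4
examples close by `norm_num`). NOT here: the informative window (§2.4 (c)), the material verdict (§4.5), the
ordering statistic (§4.6) — finite bookkeeping whose one stated property is (a) — and the H > 0 clause of §2.3.
-/

namespace Summit.Ventures.CertifiedManyBodySolver.Downfold

namespace CellScore

/-! ## §1 Truth of a cell (ACCEPTANCE §2.3) -/

/-- The three truth values of a (T, P, H) cell derived from a curated column: superconducting,
normal, or unknown (inside the tolerance / below the lowest measured temperature / no column). [folklore] -/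
inductive Truth
  /-- the curated diagram says superconducting at this cell -/
  | SC
  /-- the curated diagram says normal at this cell -/
  | not
  /-- the curated diagram does not decide this cell -/
  | unknown
  deriving DecidableEq, Repr

/-- ACCEPTANCE §2.3 tolerance `τ(T_c) = max(Tc_err_K, 1 K, 0.05·Tc_K)` [v1-proposed]. [folklore] -/
def tau (Tc err : ℚ) : ℚ := max err (max 1 (Tc / 20))

/-- ACCEPTANCE §2.3 truth of a cell at temperature `T` on a column with status SC, measured `Tc` and
tolerance `τ`: «T = 0 ⇒ SC (ground state); T < Tc − τ ⇒ SC; T > Tc + τ ⇒ not; otherwise unknown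
(inside the tolerance)». [folklore] -/
def truthSC (Tc τ T : ℚ) : Truth :=
  if T = 0 then .SC else if T < Tc - τ then .SC else if Tc + τ < T then .not else .unknown

/-- ACCEPTANCE §2.3 truth of a cell on a column with status «noSC-down-to T_min»: «T ≥ T_min ⇒ not;
T < T_min ⇒ unknown» (nothing was measured there). [folklore] -/
def truthNoSC (Tmin T : ℚ) : Truth := if Tmin ≤ T then .not else .unknown

/-! ## §2 Words, outcomes, bands -/

/-- The three map words of a cell (ACCEPTANCE §2.1 `cells[].word`). [folklore] -/
inductive Word
  /-- the map asserts superconductivity at this cell -/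
  | SC
  /-- the map asserts a normal state at this cell -/
  | not
  /-- the map abstains (with a reason; no confidence class) -/
  | undetermined
  deriving DecidableEq, Repr

/-- The four scoring outcomes of one cell (ACCEPTANCE §4.3): agree / disagree (decided, truth known),
unscored (decided, truth unknown), abstain (undetermined — «counted, not a miss»). [folklore] -/
inductive Outcome
  /-- decided word equals the known truth -/
  | agree
  /-- decided word contradicts the known truth -/
  | disagree
  /-- decided word, truth unknown: in no accuracy numerator or denominator -/
  | unscored
  /-- undetermined word: enters coverage/abstention only -/
  | abstain
  deriving DecidableEq, Repr

/-- ACCEPTANCE §4.3 cell outcome of a map word against a truth value. [folklore] -/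
def outcome : Word → Truth → Outcome
  | .undetermined, _ => .abstain
  | .SC, .unknown => .unscored
  | .not, .unknown => .unscored
  | .SC, .SC => .agree
  | .not, .not => .agree
  | .SC, .not => .disagree
  | .not, .SC => .disagree

/-- ACCEPTANCE §4.4 «INSIDE»: the measured `Tc` lies in the band widened by the tolerance,
`Tc ∈ [lo − τ, hi + τ]` (a Boolean, as the scorers print it). [folklore] -/
def inside (lo hi Tc τ : ℚ) : Bool := decide (lo - τ ≤ Tc) && decide (Tc ≤ hi + τ)

/-- ACCEPTANCE §4.1 W3, per cell of a column carrying the band `[lo, hi]`: «cells with T < lo are SC or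
undetermined (INCLUDING T = 0); cells with T > hi are not or undetermined; inside [lo, hi] any word».
A map violating it is rejected before scoring, so every SCORED column satisfies it. [folklore] -/
def w3Cell (lo hi T : ℚ) (w : Word) : Bool :=
  !(decide (T < lo) && decide (w = .not)) && !(decide (hi < T) && decide (w = .SC))

/-- `inside` unfolded to its two inequalities. [folklore] -/
theorem inside_iff {lo hi Tc τ : ℚ} : inside lo hi Tc τ = true ↔ lo - τ ≤ Tc ∧ Tc ≤ hi + τ := by
  simp [inside]

/-- `w3Cell` unfolded to its two implications. [folklore] -/
theorem w3Cell_iff {lo hi T : ℚ} {w : Word} :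
    w3Cell lo hi T w = true ↔ (T < lo → w ≠ .not) ∧ (hi < T → w ≠ .SC) := by
  simp [w3Cell, imp_iff_not_or]

/-! ## §3 Property sheet -/

section honesty

/-- HONESTY («undetermined is counted, never a miss», D-0099 / §13): an undetermined word abstains
whatever the truth. [folklore] -/
theorem outcome_undetermined (t : Truth) : outcome .undetermined t = .abstain := by
  cases t <;> rfl

/-- A cell whose truth is unknown is never a disagreement (it is unscored or an abstention). [folklore] -/
theorem outcome_unknown_ne_disagree (w : Word) : outcome w .unknown ≠ .disagree := by
  cases w <;> simp [outcome]

/-- The only disagreements are SC-vs-not and not-vs-SC. [folklore] -/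
theorem outcome_eq_disagree_iff (w : Word) (t : Truth) :
    outcome w t = .disagree ↔ (w = .SC ∧ t = .not) ∨ (w = .not ∧ t = .SC) := by
  cases w <;> cases t <;> simp [outcome]

end honesty

section tolerance

variable (Tc err : ℚ)

/-- τ ≥ 1 K. [folklore] -/
theorem one_le_tau : 1 ≤ tau Tc err :=
  le_trans (le_max_left 1 (Tc / 20)) (le_max_right err _)

/-- τ ≥ the curator's stated error. [folklore] -/
theorem err_le_tau : err ≤ tau Tc err := le_max_left err _

/-- τ ≥ 5 % of T_c. [folklore] -/
theorem twentieth_le_tau : Tc / 20 ≤ tau Tc err :=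
  le_trans (le_max_right 1 (Tc / 20)) (le_max_right err _)

/-- τ > 0. [folklore] -/
theorem tau_pos : 0 < tau Tc err := lt_of_lt_of_le one_pos (one_le_tau Tc err)

end tolerance

section truth

variable {Tc τ T : ℚ}

/-- The ground state of a superconducting column is SC (§2.3 «T = 0 ⇒ SC»). [folklore] -/
theorem truthSC_zero (Tc τ : ℚ) : truthSC Tc τ 0 = .SC := by
  simp [truthSC]

/-- Below the tolerance window the truth is SC. [folklore] -/
theorem truthSC_of_lt (h : T < Tc - τ) : truthSC Tc τ T = .SC := by
  unfold truthSC
  split_ifs <;> rfl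

/-- Above the tolerance window (and off the ground state) the truth is «not». [folklore] -/
theorem truthSC_of_gt (hT : T ≠ 0) (hτ : 0 ≤ τ) (h : Tc + τ < T) : truthSC Tc τ T = .not := by
  unfold truthSC
  have h' : ¬ T < Tc - τ := by
    intro h''
    linarith
  simp [hT, h', h]

/-- Inside the closed tolerance window (off the ground state) the truth is unknown. [folklore] -/
theorem truthSC_of_mem (hT : T ≠ 0) (h₁ : Tc - τ ≤ T) (h₂ : T ≤ Tc + τ) : truthSC Tc τ T = .unknown := by
  unfold truthSC
  have h₁' : ¬ T < Tc - τ := not_lt.mpr h₁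
  have h₂' : ¬ Tc + τ < T := not_lt.mpr h₂
  simp [hT, h₁', h₂']

/-- A cell at or below `Tc + τ` is never «not». [folklore] -/
theorem truthSC_ne_not_of_le (h : T ≤ Tc + τ) : truthSC Tc τ T ≠ .not := by
  unfold truthSC
  split_ifs with h0 h1 h2
  · simp
  · simp
  · exact absurd h2 (not_lt.mpr h)
  · simp

/-- A cell off the ground state at or above `Tc − τ` is never SC. [folklore] -/
theorem truthSC_ne_SC_of_ge (hT : T ≠ 0) (h : Tc - τ ≤ T) : truthSC Tc τ T ≠ .SC := by
  unfold truthSC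
  split_ifs with h0 h1 h2
  · exact absurd h0 hT
  · exact absurd h1 (not_lt.mpr h)
  · simp
  · simp

/-- MONOTONICITY (downward closure of SC): on the non-negative temperature axis, if the truth is SC at
`T₂` it is SC at every `T₁ ≤ T₂`. [folklore] -/
theorem truthSC_SC_anti {T₁ T₂ : ℚ} (h0 : 0 ≤ T₁) (h12 : T₁ ≤ T₂) (h : truthSC Tc τ T₂ = .SC) :
    truthSC Tc τ T₁ = .SC := by
  unfold truthSC at h ⊢
  by_cases hz : T₁ = 0
  · simp [hz]
  · split_ifs at h with h2z h2lt h2gt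
    · exact absurd (le_antisymm (h2z ▸ h12) h0) hz
    · have : T₁ < Tc - τ := lt_of_le_of_lt h12 h2lt
      simp [hz, this]

/-- MONOTONICITY (upward closure of «not»): if the truth is «not» at `T₁ ≥ 0` it is «not» at every
`T₂ ≥ T₁` (τ ≥ 0). [folklore] -/
theorem truthSC_not_mono {T₁ T₂ : ℚ} (h0 : 0 ≤ T₁) (h12 : T₁ ≤ T₂) (hτ : 0 ≤ τ)
    (h : truthSC Tc τ T₁ = .not) : truthSC Tc τ T₂ = .not := by
  unfold truthSC at h
  split_ifs at h with h1z h1lt h1gt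
  have hT₂ : T₂ ≠ 0 := by
    intro hz
    have : T₁ = 0 := le_antisymm (hz ▸ h12) h0
    exact h1z this
  exact truthSC_of_gt hT₂ hτ (lt_of_lt_of_le h1gt h12)

/-- The measured-normal column: at or above `T_min` the truth is «not», below it unknown. [folklore] -/
theorem truthNoSC_of_le {Tmin T : ℚ} (h : Tmin ≤ T) : truthNoSC Tmin T = .not := by
  simp [truthNoSC, h]

/-- The measured-normal column below `T_min` is unknown (nothing measured there). [folklore] -/
theorem truthNoSC_of_lt {Tmin T : ℚ} (h : T < Tmin) : truthNoSC Tmin T = .unknown := by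
  simp [truthNoSC, not_le.mpr h]

/-- The measured-normal column is never SC. [folklore] -/
theorem truthNoSC_ne_SC (Tmin T : ℚ) : truthNoSC Tmin T ≠ .SC := by
  unfold truthNoSC
  split_ifs <;> simp

end truth

section band

variable {lo hi Tc τ T : ℚ} {w : Word}

/-- THE INSIDE-BAND THEOREM (§4.4 ⇒ §4.3): on a well-formed band `0 ≤ lo ≤ hi` that is INSIDE
(`Tc ∈ [lo − τ, hi + τ]`, τ ≥ 0), a W3-consistent cell OUTSIDE `[lo, hi]` never disagrees with truth.
Hence an inside band can lose cell accuracy only through words decided inside the band itself. [folklore] -/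
theorem outcome_ne_disagree_of_inside (hlo : 0 ≤ lo) (hlohi : lo ≤ hi) (hin : inside lo hi Tc τ = true)
    (hW3 : w3Cell lo hi T w = true) (hout : T < lo ∨ hi < T) :
    outcome w (truthSC Tc τ T) ≠ .disagree := by
  rcases hout with hlt | hgt
  · -- below the band: the word is SC or undetermined, the truth is SC or unknown
    have hwn : w ≠ .not := (w3Cell_iff.mp hW3).1 hlt
    have hle : T ≤ Tc + τ := by
      have := (inside_iff.mp hin).1
      linarith
    have htr : truthSC Tc τ T ≠ .not := truthSC_ne_not_of_le hle
    rw [Ne, outcome_eq_disagree_iff]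
    rintro (⟨_, ht⟩ | ⟨hw, _⟩)
    · exact htr ht
    · exact hwn hw
  · -- above the band: the word is not or undetermined, the truth is not or unknown
    have hws : w ≠ .SC := (w3Cell_iff.mp hW3).2 hgt
    have hT : T ≠ 0 := by
      intro hz
      subst hz
      linarith
    have hge : Tc - τ ≤ T := by
      have := (inside_iff.mp hin).2
      linarith
    have htr : truthSC Tc τ T ≠ .SC := truthSC_ne_SC_of_ge hT hge
    rw [Ne, outcome_eq_disagree_iff]
    rintro (⟨hw, _⟩ | ⟨_, ht⟩)
    · exact hws hw
    · exact htr ht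

/-- Corollary: under the same hypotheses a DECIDED cell outside the band agrees or is unscored. [folklore] -/
theorem outcome_agree_or_unscored_of_inside (hlo : 0 ≤ lo) (hlohi : lo ≤ hi) (hin : inside lo hi Tc τ = true)
    (hW3 : w3Cell lo hi T w = true) (hout : T < lo ∨ hi < T) (hw : w ≠ .undetermined) :
    outcome w (truthSC Tc τ T) = .agree ∨ outcome w (truthSC Tc τ T) = .unscored := by
  have h := outcome_ne_disagree_of_inside hlo hlohi hin hW3 hout
  revert h hw
  cases w <;> cases truthSC Tc τ T <;> simp [outcome]

/-- THE MISS-HIGH THEOREM: if the band sits above the truth by more than the tolerance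
(`Tc + τ < T < lo` is a non-empty stretch of the axis), every W3-consistent cell there is a
disagreement unless the producer abstained — a missed band forces level-2 errors. (`0 ≤ Tc`, `0 ≤ τ`.)
[folklore] -/
theorem disagree_or_undetermined_of_missHigh (hTc : 0 ≤ Tc) (hτ : 0 ≤ τ) (hW3 : w3Cell lo hi T w = true)
    (hlt : T < lo) (hgt : Tc + τ < T) :
    outcome w (truthSC Tc τ T) = .disagree ∨ w = .undetermined := by
  have hT : T ≠ 0 := by
    intro hz
    subst hz
    linarith
  have htr : truthSC Tc τ T = .not := truthSC_of_gt hT hτ hgt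
  have hwn : w ≠ .not := (w3Cell_iff.mp hW3).1 hlt
  revert hwn
  cases w <;> simp [outcome, htr]

/-- THE MISS-LOW THEOREM: if the band sits below the truth by more than the tolerance, every
W3-consistent cell with `hi < T < Tc − τ` (off the ground state) disagrees unless undetermined. [folklore] -/
theorem disagree_or_undetermined_of_missLow (hW3 : w3Cell lo hi T w = true) (hgt : hi < T) (hlt : T < Tc - τ) :
    outcome w (truthSC Tc τ T) = .disagree ∨ w = .undetermined := by
  have htr : truthSC Tc τ T = .SC := truthSC_of_lt hlt
  have hws : w ≠ .SC := (w3Cell_iff.mp hW3).2 hgt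
  revert hws
  cases w <;> simp [outcome, htr]

/-- Measured-normal column, band wholly BELOW the lowest measured temperature (`hi < T_min`, §4.4 «OK»):
no W3-consistent cell disagrees (above T_min the word is «not» or undetermined and the truth «not»;
below T_min the truth is unknown). [folklore] -/
theorem outcome_ne_disagree_noSC_of_hi_lt {Tmin : ℚ} (h : hi < Tmin) (hW3 : w3Cell lo hi T w = true) :
    outcome w (truthNoSC Tmin T) ≠ .disagree := by
  by_cases hT : Tmin ≤ T
  · have hws : w ≠ .SC := (w3Cell_iff.mp hW3).2 (lt_of_lt_of_le h hT)
    rw [truthNoSC_of_le hT]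
    revert hws
    cases w <;> simp [outcome]
  · rw [truthNoSC_of_lt (not_le.mp hT)]
    exact outcome_unknown_ne_disagree w

/-- Measured-normal column, no band at all: a column of «not»/undetermined words never disagrees.
[folklore] -/
theorem outcome_ne_disagree_noSC_of_ne_SC {Tmin : ℚ} (hw : w ≠ .SC) :
    outcome w (truthNoSC Tmin T) ≠ .disagree := by
  have h := truthNoSC_ne_SC Tmin T
  revert hw h
  cases w <;> cases truthNoSC Tmin T <;> simp [outcome]

/-- THE FALSE-BAND THEOREM (§4.4 «FALSE-BAND if lo > T_min_measured: the oracle predicts SC where none is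
seen»): every W3-consistent cell with `T_min ≤ T < lo` is a disagreement unless undetermined. [folklore] -/
theorem disagree_or_undetermined_of_falseBand {Tmin : ℚ} (hW3 : w3Cell lo hi T w = true) (hT : Tmin ≤ T)
    (hlt : T < lo) : outcome w (truthNoSC Tmin T) = .disagree ∨ w = .undetermined := by
  have hwn : w ≠ .not := (w3Cell_iff.mp hW3).1 hlt
  rw [truthNoSC_of_le hT]
  revert hwn
  cases w <;> simp [outcome]

end band

/-! ## §4 The MgB₂ column of record, evaluated (truth file M07: SC, T_c = 39 ± 1 K at P = 0 ⇒
τ = max(1, 1, 39/20) = 39/20 K; the unit tests of both python engines use the same numbers) -/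

section cases

/-- τ(39 K, ±1 K) = 1.95 K. [folklore] -/
example : tau 39 1 = 39 / 20 := by norm_num [tau]
example : tau (118 / 100) (5 / 100) = 1 := by norm_num [tau]      -- Al: the 1 K floor binds
example : tau 150 50 = 50 := by norm_num [tau]                    -- H₃S @ 100 GPa: the error binds
example : truthSC 39 (39 / 20) 0 = .SC := by norm_num [truthSC]
example : truthSC 39 (39 / 20) 30 = .SC := by norm_num [truthSC]
example : truthSC 39 (39 / 20) 40 = .unknown := by norm_num [truthSC]
example : truthSC 39 (39 / 20) 50 = .not := by norm_num [truthSC]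
example : truthSC 39 (39 / 20) (741 / 20) = .unknown := by norm_num [truthSC]   -- edge T = Tc − τ = 37.05: unknown
example : truthSC 39 (39 / 20) (819 / 20) = .unknown := by norm_num [truthSC]   -- edge T = Tc + τ = 40.95: unknown
/-- La₂CuO₄ (M13, no SC down to 4.2 K): T = 4 unknown, T = 6 «not» -/
example : truthNoSC (42 / 10) 4 = .unknown := by norm_num [truthNoSC]
example : truthNoSC (42 / 10) 6 = .not := by norm_num [truthNoSC]
/-- band [33, 42] K is INSIDE for T_c = 39, τ = 1.95; band [45, 60] misses high (45 − 1.95 > 39);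
band [36, 37.5] sits below T_c by less than τ, hence still INSIDE (37.5 + 1.95 ≥ 39); [36, 37] is not -/
example : inside 33 42 39 (39 / 20) = true := by norm_num [inside]
example : inside 45 60 39 (39 / 20) = false := by norm_num [inside]
example : inside 36 (75 / 2) 39 (39 / 20) = true := by norm_num [inside]
example : inside 36 37 39 (39 / 20) = false := by norm_num [inside]
/-- W3 on band [33, 42]: «not» at T = 30 is a violation, «SC» at T = 30 and «not» at T = 50 are fine -/
example : w3Cell 33 42 30 .not = false := by norm_num [w3Cell]
example : w3Cell 33 42 30 .SC = true := by (norm_num [w3Cell]; simp)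
example : w3Cell 33 42 50 .not = true := by (norm_num [w3Cell]; simp)
example : outcome .SC (truthSC 39 (39 / 20) 30) = .agree := by norm_num [truthSC, outcome]
example : outcome .not (truthSC 39 (39 / 20) 30) = .disagree := by norm_num [truthSC, outcome]
example : outcome .SC (truthSC 39 (39 / 20) 40) = .unscored := by norm_num [truthSC, outcome]
example : outcome .undetermined (truthSC 39 (39 / 20) 50) = .abstain := by norm_num [truthSC, outcome]
/-- a miss-high band [45, 60]: the SC cell a W3-consistent producer must write at T = 44 disagrees -/
example : outcome .SC (truthSC 39 (39 / 20) 44) = .disagree := by norm_num [truthSC, outcome]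

end cases

end CellScore

end Summit.Ventures.CertifiedManyBodySolver.Downfold
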